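import Summits.ValiantsHypothesis.ValiantsHypothesis.Theses.BorderApolarity

/-!
# `ToricFixedPoints` — negative lemma: the orbit hypothesis is load-bearing

Crux `Summit.ValiantsHypothesis.ValiantsHypothesis.Theses.BorderApolarity.ToricFixedPoints`
(stmt-ValiantsHypothesis-5779).  `ToricFixedPointsWithoutOrbit` is the crux with the hypothesis
`∀ t, P t ∈ GL·det_m` deleted (text otherwise verbatim); `toricFixedPoints_false_without_orbit` proves it
is false (witness `n = m = 3`, `P_t = 0`, `J_k` = all degree-`k` forms; the conclusion fails in degree 0
because translates of `det_3` are non-zero).  Refuter cdisprove unit, cycle 1. [folklore]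
-/

namespace Summit.ValiantsHypothesis.Cruxes.ToricFixedPoints.Negative

open Literature.Computability.AlgebraicComplexity
open scoped BigOperators Matrix

/-! ## The statement without the orbit hypothesis

`ToricFixedPointsWithoutOrbit` is the crux with the hypothesis `∀ t, P t ∈ GL·det_m` deleted
(text otherwise verbatim).  It is FALSE: without it `P_t = 0` is allowed, whose annihilator data
`J_k = {all degree-k forms}` is trivially `H₀`-stable, while the degree-0 part of any toric limit
`lim Ann(u·diag((t+2)^w)·g·det_m)` is `0` because translates of `det_m` are non-zero
(`Matrix.det_mvPolynomialX_ne_zero` + injectivity of invertible substitutions).  Moral for provers: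
every use of the conclusion in small degree goes through `P_t ≠ 0` / conciseness of `det_m`, which
enter ONLY through the orbit hypothesis. -/

/-- The crux `ToricFixedPoints` with the hypothesis `(∀ t, P t ∈ glOrbit det_m)` removed. -/
def ToricFixedPointsWithoutOrbit : Prop :=
  ∀ (n m : ℕ) [NeZero m], 3 ≤ n → n ≤ m → let act := fun (D f : MvPolynomial (Fin m × Fin m) ℂ) => ∑ e ∈ D.support, ∑ d ∈ f.support, MvPolynomial.monomial (d - e) (MvPolynomial.coeff e D * MvPolynomial.coeff d f * ∏ i ∈ e.support, (Nat.descFactorial (d i) (e i) : ℂ)); let rk := fun (p : Fin m × Fin m) => (if (m - n ≤ (p.1 : ℕ) ∧ m - n ≤ (p.2 : ℕ)) ∨ p = (0, 0) then 0 else m * m) + ((p.1 : ℕ) * m + (p.2 : ℕ)); ∀ (P : ℕ → MvPolynomial (Fin m × Fin m) ℂ) (J : ℕ → Set (MvPolynomial (Fin m × Fin m) ℂ)), (∀ k ≤ m, ∀ D ∈ J k, ∃ Ds : ℕ → MvPolynomial (Fin m × Fin m) ℂ, (∀ t, (Ds t).IsHomogeneous k ∧ act (Ds t) (P t) = 0)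 ∧ Filter.Tendsto (fun t => Literature.Computability.AlgebraicComplexity.coeffVec (Ds t)) Filter.atTop (nhds (Literature.Computability.AlgebraicComplexity.coeffVec D))) ∧ (∀ k ≤ m, ∀ (D : MvPolynomial (Fin m × Fin m) ℂ) (φ : ℕ → ℕ) (Ds : ℕ → MvPolynomial (Fin m × Fin m) ℂ), StrictMono φ → (∀ t, (Ds t).IsHomogeneous k ∧ act (Ds t) (P (φ t)) = 0) → Filter.Tendsto (fun t => Literature.Computability.AlgebraicComplexity.coeffVec (Ds t)) Filter.atTop (nhds (Literature.Computability.AlgebraicComplexity.coeffVec D)) → D ∈ J k) → (∀ A : Matrix.GeneralLinearGroup (Fin m × Fin m) ℂ, let M : Matrix (Fin m × Fin m) (Fin m × Fin m) ℂ := A; (∀ i j : Fin m × Fin m, M j i ≠ 0 → rk j ≤ rk i) → (∀ i j : Fin m × Fin m, ((m - n ≤ (i.1 : ℕ) ∧ m - n ≤ (i.2 : ℕ)) ∨ i = (0, 0)) → j ≠ i → M j i = 0) → (∀ i k j l : Fin m, m - n ≤ (i : ℕ) → m - n ≤ (k : ℕ) → m - n ≤ (j : ℕ) → m - n ≤ (l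 : ℕ) → M (i, j) (i, j) * M (k, l) (k, l) = M (i, l) (i, l) * M (k, j) (k, j)) → M (0, 0) (0, 0) ^ (m - n) * ∏ i ∈ Finset.univ.filter (fun i : Fin m => m - n ≤ (i : ℕ)), M (i, i) (i, i) = 1 → ∀ k ≤ m, ∀ D ∈ J k, Literature.Computability.AlgebraicComplexity.linSubst (Fin m × Fin m) ℂ Mᵀ D ∈ J k) → ∃ (u g : Matrix.GeneralLinearGroup (Fin m × Fin m) ℂ) (w : Fin m × Fin m → ℤ), let Q : ℕ → MvPolynomial (Fin m × Fin m) ℂ := fun t => Literature.Computability.AlgebraicComplexity.linSubst (Fin m × Fin m) ℂ (u : Matrix (Fin m × Fin m) (Fin m × Fin m) ℂ) (Literature.Computability.AlgebraicComplexity.linSubst (Fin m × Fin m) ℂ (Matrix.diagonal fun i : Fin m × Fin m => ((t : ℂ) + 2) ^ (w i)) (Literature.Computability.AlgebraicComplexity.linSubst (Fin m × Fin m) ℂ (g : Matrix (Fin m × Fin m) (Fin m × Fin m) ℂ) (Literature.Computability.AlgebraicComplexity.detPoly (Fin m) ℂ))); (∀ k ≤ m, ∀ D ∈ J k, ∃ Ds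 : ℕ → MvPolynomial (Fin m × Fin m) ℂ, (∀ t, (Ds t).IsHomogeneous k ∧ act (Ds t) (Q t) = 0) ∧ Filter.Tendsto (fun t => Literature.Computability.AlgebraicComplexity.coeffVec (Ds t)) Filter.atTop (nhds (Literature.Computability.AlgebraicComplexity.coeffVec D))) ∧ (∀ k ≤ m, ∀ (D : MvPolynomial (Fin m × Fin m) ℂ) (φ : ℕ → ℕ) (Ds : ℕ → MvPolynomial (Fin m × Fin m) ℂ), StrictMono φ → (∀ t, (Ds t).IsHomogeneous k ∧ act (Ds t) (Q (φ t)) = 0) → Filter.Tendsto (fun t => Literature.Computability.AlgebraicComplexity.coeffVec (Ds t)) Filter.atTop (nhds (Literature.Computability.AlgebraicComplexity.coeffVec D)) → D ∈ J k)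

/-- Invertible linear substitutions are injective on polynomials (from `linSubst_mul`, `linSubst_one`). -/
theorem linSubst_injective_of_mul_eq_one {σ : Type*} [Fintype σ] [DecidableEq σ]
    (A B : Matrix σ σ ℂ) (h : B * A = 1) : Function.Injective (linSubst σ ℂ A) := by
  intro f g hfg
  have h2 := congrArg (linSubst σ ℂ B) hfg
  rwa [← AlgHom.comp_apply, ← AlgHom.comp_apply, ← linSubst_mul, h, linSubst_one,
    AlgHom.id_apply, AlgHom.id_apply] at h2

/-- The apolarity action of a non-zero constant `C c` (the crux's inline `act`) is multiplication by `c`. -/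
theorem act_C_eq_smul {m : ℕ} (c : ℂ) (hc : c ≠ 0) (f : MvPolynomial (Fin m × Fin m) ℂ) :
    (∑ e ∈ (MvPolynomial.C c : MvPolynomial (Fin m × Fin m) ℂ).support, ∑ d ∈ f.support,
      MvPolynomial.monomial (d - e) (MvPolynomial.coeff e (MvPolynomial.C c : MvPolynomial (Fin m × Fin m) ℂ) *
        MvPolynomial.coeff d f * ∏ i ∈ e.support, (Nat.descFactorial (d i) (e i) : ℂ))) = c • f := by
  classical
  have hsupp : (MvPolynomial.C c : MvPolynomial (Fin m × Fin m) ℂ).support = {0} := by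
    rw [MvPolynomial.C_apply, MvPolynomial.support_monomial, if_neg hc]
  rw [hsupp, Finset.sum_singleton]
  simp only [tsub_zero, MvPolynomial.coeff_zero_C, Finsupp.support_zero, Finset.prod_empty, mul_one]
  conv_rhs => rw [f.as_sum, Finset.smul_sum]
  refine Finset.sum_congr rfl fun d _ => ?_
  rw [MvPolynomial.smul_monomial, smul_eq_mul]

/-- §1: `ToricFixedPointsWithoutOrbit` is false — witness `n = m = 3`, `P_t = 0`,
`J_k = {D : D homogeneous of degree k}`; the conclusion fails in degree `k = 0` at `D = C 1`. -/
theorem toricFixedPoints_false_without_orbit : ¬ ToricFixedPointsWithoutOrbit := by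
  intro h
  have h3 := @h 3 3 inferInstance le_rfl le_rfl
  dsimp only at h3
  refine absurd (h3 (fun _ => 0) (fun k => {D | D.IsHomogeneous k}) ⟨?_, ?_⟩ ?_) ?_
  · -- W1 for the constant zero sequence
    intro k _hk D hD
    refine ⟨fun _ => D, fun t => ⟨hD, ?_⟩, tendsto_const_nhds⟩
    simp [MvPolynomial.support_zero]
  · -- W2: coefficientwise limits of degree-k forms are degree-k forms
    intro k _hk D φ Ds _hφ hDs hlim d hd
    by_contra hne
    apply hd
    have hc : Filter.Tendsto (fun t => MvPolynomial.coeff d (Ds t)) Filter.atTop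
        (nhds (MvPolynomial.coeff d D)) := by
      have := tendsto_pi_nhds.mp hlim d
      simpa [coeffVec] using this
    have hdk : d.degree ≠ k := by
      intro hh; apply hne; rw [Finsupp.degree_eq_weight_one] at hh; exact hh
    have h0 : (fun t => MvPolynomial.coeff d (Ds t)) = fun _ => (0 : ℂ) :=
      funext fun t => (hDs t).1.coeff_eq_zero hdk
    rw [h0] at hc
    exact tendsto_nhds_unique hc tendsto_const_nhds
  · -- W3: H₀-stability of J (any linear substitution preserves degree-k forms)
    intro A _h1 _h2 _h3 _h4 k _hk D hD
    exact linSubst_isHomogeneous _ hD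
  · -- the conclusion fails: degree 0, D = C 1
    rintro ⟨u, g, w, hW1', -⟩
    obtain ⟨Ds, hDs, hlim⟩ := hW1' 0 (Nat.zero_le _) (MvPolynomial.C 1) (MvPolynomial.isHomogeneous_C _ 1)
    have hQ : ∀ t : ℕ, linSubst (Fin 3 × Fin 3) ℂ (u : Matrix (Fin 3 × Fin 3) (Fin 3 × Fin 3) ℂ)
        (linSubst (Fin 3 × Fin 3) ℂ (Matrix.diagonal fun i : Fin 3 × Fin 3 => ((t : ℂ) + 2) ^ (w i))
          (linSubst (Fin 3 × Fin 3) ℂ (g : Matrix (Fin 3 × Fin 3) (Fin 3 × Fin 3) ℂ) (detPoly (Fin 3) ℂ))) ≠ 0 := by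
      intro t
      have hdet : detPoly (Fin 3) ℂ ≠ 0 := Matrix.det_mvPolynomialX_ne_zero (Fin 3) ℂ
      have hu := linSubst_injective_of_mul_eq_one (u : Matrix (Fin 3 × Fin 3) (Fin 3 × Fin 3) ℂ)
        ((u⁻¹ : Matrix.GeneralLinearGroup (Fin 3 × Fin 3) ℂ) : Matrix (Fin 3 × Fin 3) (Fin 3 × Fin 3) ℂ) (by simp)
      have hg := linSubst_injective_of_mul_eq_one (g : Matrix (Fin 3 × Fin 3) (Fin 3 × Fin 3) ℂ)
        ((g⁻¹ : Matrix.GeneralLinearGroup (Fin 3 × Fin 3) ℂ) : Matrix (Fin 3 × Fin 3) (Fin 3 × Fin 3) ℂ) (by simp)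
      have ht2 : ((t : ℂ) + 2) ≠ 0 := by
        have : (0 : ℝ) < (t : ℝ) + 2 := by positivity
        exact_mod_cast this.ne'
      have hd := linSubst_injective_of_mul_eq_one
        (Matrix.diagonal fun i : Fin 3 × Fin 3 => ((t : ℂ) + 2) ^ (w i))
        (Matrix.diagonal fun i : Fin 3 × Fin 3 => (((t : ℂ) + 2) ^ (w i))⁻¹) (by
          rw [Matrix.diagonal_mul_diagonal, ← Matrix.diagonal_one]
          congr 1; funext i; exact inv_mul_cancel₀ (zpow_ne_zero _ ht2))
      rw [Ne, ← map_zero (linSubst (Fin 3 × Fin 3) ℂ (u : Matrix (Fin 3 × Fin 3) (Fin 3 × Fin 3) ℂ)), hu.eq_iff,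
        ← map_zero (linSubst (Fin 3 × Fin 3) ℂ (Matrix.diagonal fun i : Fin 3 × Fin 3 => ((t : ℂ) + 2) ^ (w i))),
        hd.eq_iff, ← map_zero (linSubst (Fin 3 × Fin 3) ℂ (g : Matrix (Fin 3 × Fin 3) (Fin 3 × Fin 3) ℂ)), hg.eq_iff]
      exact hdet
    have hDs0 : ∀ t, Ds t = 0 := by
      intro t
      by_contra hne
      obtain ⟨hhom, hact⟩ := hDs t
      have htd : (Ds t).totalDegree = 0 := hhom.totalDegree hne
      rw [MvPolynomial.totalDegree_eq_zero_iff_eq_C] at htd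
      have hc0 : MvPolynomial.coeff 0 (Ds t) ≠ 0 := by
        intro h0; apply hne; rw [htd, h0, map_zero]
      rw [htd, act_C_eq_smul _ hc0] at hact
      exact hQ t ((smul_eq_zero.mp hact).resolve_left hc0)
    have hconst : (fun t => coeffVec (Ds t)) = fun _ => coeffVec (0 : MvPolynomial (Fin 3 × Fin 3) ℂ) :=
      funext fun t => by rw [hDs0]
    rw [hconst] at hlim
    have h01 : coeffVec (MvPolynomial.C 1 : MvPolynomial (Fin 3 × Fin 3) ℂ) =
        coeffVec (0 : MvPolynomial (Fin 3 × Fin 3) ℂ) := tendsto_nhds_unique hlim tendsto_const_nhds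
    have := coeffVec_injective h01
    simp at this



end Summit.ValiantsHypothesis.Cruxes.ToricFixedPoints.Negative
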